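import Mathlib.Topology.MetricSpace.Thickening
import Literature.Probability.RandomPlanarGeometry.HalfPlaneFill
import Literature.Probability.RandomPlanarGeometry.HullApproximation
import Literature.Probability.RandomPlanarGeometry.RestrictionSemigroup
import HarnessLib

/-!
# Thickened hulls and the behaviour of restriction maps at `0` and `∞`

Half-plane tools for the approximation step of the uniqueness half of

* G. F. Lawler, O. Schramm, W. Werner, *Conformal restriction: the chordal case*, J. Amer.
  Math. Soc. **16** (2003) 917–955, arXiv:math/0209343 (**[LSW]**),

namely the passage from multiplicativity `F(A · J) = F(A) F(J)` of the avoidance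
probabilities over SMOOTH hulls `J` (which is what restriction over Jordan subdomains gives) to
all `*`-hulls (`RestrictionCovariance`). Two devices are PROVED here:

1. **Thickened hulls** `Literature.thickHull A s = hpFill ({dist(·, A) ≤ s} ∩ {Im ≥ 0})`, the
   half-plane fill ([LSW] §2 p. 8 "Fillings"; `HalfPlaneFill.hpFill`) of the closed
   `s`-neighbourhood of `A` in `ℍ̄`. For `A ∈ 𝒬*` and small `s > 0`: `thickHull A s ∈ 𝒬*`
   (`isStarHull_thickHull`; the neighbourhood is attached to `ℝ` because a bounded hull has no
   floating pieces, `IsBoundedHull.isConnected_union_im_nonpos`), `A ∩ ℍ ⊆ thickHull A s`,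
   monotone in `s`, each contained in the INTERIOR of the next
   (`thickHull_inter_subset_interior`), and every connected unbounded `L ⊆ ℍ` whose closure
   misses `A` misses `thickHull A s` for small `s` (`exists_forall_disjoint_thickHull`, the outer
   continuity of avoidance events). Monotonicity in `s` is what makes touching events
   harmless in the limit argument of `RestrictionCovariance`.
2. **Restriction maps at `0` and `∞`**: for `K ∈ Ω` avoiding `A'` and a restriction map `Φ'`
   of `A'`, the image `Φ'(K)` is a connected unbounded subset of `ℍ` accumulating on `ℝ` only at
   `0` (`closure_image_subset`); and a **uniform far-field bound** (`exists_forall_lt_norm_apply`):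
   if restriction maps `Ψ_n` of `J_n ↓ A'` converge to `Φ'` uniformly on a half-circle
   `{|z| = ρ} ∩ ℍ` with real feet off `A'`, then for all large `n`, `|Ψ_n(z)| > M` whenever
   `|z| > ρ` — the image of the outer region is the outer complementary piece of the image of
   the half-circle, since the inner piece contains the points near `0 = Ψ_n(0)`.
-/

noncomputable section

open Set Filter Topology Metric Bornology Complex
open UpperHalfPlane (upperHalfPlaneSet isOpen_upperHalfPlaneSet)
open scoped NNReal

namespace Literature.Probability.RandomPlanarGeometry

/-! ### Monotonicity of the half-plane fill -/

section FillMono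

variable {S S' : Set ℂ}

/-- The unbounded component of `ℍ ∖ S` decreases as `S` increases. [folklore] -/
theorem unboundedComponent_anti (h : S ⊆ S') :
    Loewner.unboundedComponent (upperHalfPlaneSet \ S') ⊆
      Loewner.unboundedComponent (upperHalfPlaneSet \ S) := by
  intro z hz
  refine ⟨⟨hz.1.1, fun hzS ↦ hz.1.2 (h hzS)⟩, fun hb ↦ hz.2 (hb.subset ?_)⟩
  exact connectedComponentIn_mono z (sdiff_subset_sdiff_right h)

/-- The fill is monotone. [folklore] -/
theorem hpFill_mono (h : S ⊆ S') : hpFill S ⊆ hpFill S' :=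
  closure_mono (sdiff_subset_sdiff_right (unboundedComponent_anti h))

/-- A point of `ℍ` off the unbounded component of `ℍ ∖ S` and off `S` has its whole (bounded,
open) component inside the fill of any `S' ⊇ S`. [folklore] -/
theorem connectedComponentIn_subset_hpFill (h : S ⊆ S') {z : ℂ}
    (hz : z ∈ upperHalfPlaneSet \ S)
    (hzV : z ∉ Loewner.unboundedComponent (upperHalfPlaneSet \ S)) :
    connectedComponentIn (upperHalfPlaneSet \ S) z ⊆ hpFill S' := by
  intro w hw
  have hwU : w ∈ upperHalfPlaneSet \ S := connectedComponentIn_subset _ _ hw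
  refine subset_closure ⟨hwU.1, fun hwV ↦ hzV ?_⟩
  have hwV' : w ∈ Loewner.unboundedComponent (upperHalfPlaneSet \ S) := unboundedComponent_anti h hwV
  refine ⟨hz, fun hb ↦ hwV'.2 ?_⟩
  rwa [← connectedComponentIn_eq hw]

end FillMono

/-! ### Closed neighbourhoods of a hull in `ℍ̄` and their fills -/

section Thick

variable {A : Set ℂ} {s s' : ℝ}

/-- The closed `s`-neighbourhood of `A` within the closed upper half-plane. [folklore] -/
def nbhdSet (A : Set ℂ) (s : ℝ) : Set ℂ := cthickening s A ∩ {z : ℂ | 0 ≤ z.im}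

/-- **Thickened hull**: the half-plane fill of the closed `s`-neighbourhood of `A` in `ℍ̄`
([LSW] §2 p. 8, "Fillings"). [cite: LawlerSchrammWerner2003Restriction, §2 p. 8 (Fillings)] -/
def thickHull (A : Set ℂ) (s : ℝ) : Set ℂ := hpFill (nbhdSet A s)

/-- The neighbourhood is closed. [folklore] -/
theorem isClosed_nbhdSet (A : Set ℂ) (s : ℝ) : IsClosed (nbhdSet A s) :=
  isClosed_cthickening.inter (isClosed_le continuous_const continuous_im)

/-- The neighbourhood of a bounded set is bounded. [folklore] -/
theorem isBounded_nbhdSet (hA : IsBounded A) (s : ℝ) : IsBounded (nbhdSet A s) :=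
  hA.cthickening.subset inter_subset_left

/-- The neighbourhoods increase with `s`. [folklore] -/
theorem nbhdSet_mono (A : Set ℂ) (h : s ≤ s') : nbhdSet A s ⊆ nbhdSet A s' :=
  inter_subset_inter_left _ (cthickening_mono h A)

/-- `A ⊆ nbhdSet A s` for `A ⊆ ℍ̄`. [folklore] -/
theorem subset_nbhdSet (hA : A ⊆ closure upperHalfPlaneSet) (s : ℝ) : A ⊆ nbhdSet A s := by
  intro z hz
  refine ⟨self_subset_cthickening A hz, ?_⟩
  have := hA hz
  rwa [Complex.closure_setOf_lt_im] at this

/-- Membership in the neighbourhood of a compact set: within `s` of a point of `A`. [folklore] -/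
theorem mem_nbhdSet_iff (hA : IsCompact A) (hs : 0 ≤ s) {z : ℂ} :
    z ∈ nbhdSet A s ↔ (∃ a ∈ A, dist z a ≤ s) ∧ 0 ≤ z.im := by
  rw [nbhdSet, mem_inter_iff, hA.cthickening_eq_biUnion_closedBall hs, mem_iUnion₂]
  simp only [mem_closedBall, exists_prop, mem_setOf_eq]

/-- The thickened hulls increase with `s`. [folklore] -/
theorem thickHull_mono (A : Set ℂ) (h : s ≤ s') : thickHull A s ⊆ thickHull A s' :=
  hpFill_mono (nbhdSet_mono A h)

/-- The thickened hull is closed. [folklore] -/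
theorem isClosed_thickHull (A : Set ℂ) (s : ℝ) : IsClosed (thickHull A s) :=
  isClosed_hpFill _

/-- `A ∩ ℍ ⊆ thickHull A s` (`A ⊆ ℍ̄`). [folklore] -/
theorem inter_subset_thickHull (hA : A ⊆ closure upperHalfPlaneSet) (s : ℝ) :
    A ∩ upperHalfPlaneSet ⊆ thickHull A s :=
  (inter_subset_inter_left _ (subset_nbhdSet hA s)).trans (inter_subset_hpFill _)

/-- **The neighbourhood of a bounded hull is attached to `ℝ`**: `nbhdSet A s ∪ {Im ≤ 0}` is
connected — `A ∪ {Im ≤ 0}` is (`IsBoundedHull.isConnected_union_im_nonpos`) and every other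
point is joined to a point of `A` by a segment inside the neighbourhood. [folklore] -/
theorem isConnected_nbhdSet_union (hA : IsBoundedHull A) (hs : 0 ≤ s) :
    IsConnected (nbhdSet A s ∪ {z : ℂ | z.im ≤ 0}) := by
  have hB := hA.isConnected_union_im_nonpos
  have hAcl : A ⊆ closure upperHalfPlaneSet := hA.subset_closure
  have hBsub : A ∪ {z : ℂ | z.im ≤ 0} ⊆ nbhdSet A s ∪ {z : ℂ | z.im ≤ 0} :=
    union_subset_union_left _ (subset_nbhdSet hAcl s)
  refine ⟨⟨0, Or.inr (by simp)⟩, isPreconnected_of_forall (-I) fun y hy ↦ ?_⟩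
  have hI : (-I : ℂ) ∈ A ∪ {z : ℂ | z.im ≤ 0} := Or.inr (by simp)
  rcases hy with hyS | hyL
  · obtain ⟨⟨a, ha, hya⟩, hyim⟩ := (mem_nbhdSet_iff hA.isCompact hs).1 hyS
    refine ⟨(A ∪ {z : ℂ | z.im ≤ 0}) ∪ segment ℝ a y, union_subset hBsub ?_, Or.inl hI,
      Or.inr (right_mem_segment _ _ _), ?_⟩
    · -- the segment stays in the neighbourhood
      intro w hw
      refine Or.inl ⟨mem_cthickening_of_dist_le w a s A ha ?_, ?_⟩
      · have hw' : w ∈ closedBall a s :=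
          (convex_closedBall a s).segment_subset (mem_closedBall_self (dist_nonneg.trans hya))
            (mem_closedBall.2 hya) hw
        exact mem_closedBall.1 hw'
      · have haim : 0 ≤ a.im := by
          have := hAcl ha
          rwa [Complex.closure_setOf_lt_im] at this
        exact (convex_halfSpace_im_ge (0 : ℝ)).segment_subset haim hyim hw
    · exact hB.isPreconnected.union a (Or.inl ha) (left_mem_segment _ _ _)
        (convex_segment a y).isPreconnected
  · exact ⟨A ∪ {z : ℂ | z.im ≤ 0}, hBsub, hI, Or.inr hyL, hB.isPreconnected⟩

/-- **For small `s` the thickened hull of a `*`-hull misses `0`**: a half-ball at `0`, a path in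
`ℍ ∖ A` to a high point and the vertical ray from there form a connected unbounded set at
positive distance from `A`, hence inside the unbounded component of the complement of every
thin neighbourhood. [folklore] -/
theorem exists_forall_zero_notMem_thickHull (hA : IsStarHull A) :
    ∃ s₀ : ℝ, 0 < s₀ ∧ ∀ s, 0 ≤ s → s < s₀ → (0 : ℂ) ∉ thickHull A s := by
  have hAc : IsClosed A := hA.isBoundedHull.isClosed
  have hU : IsOpen (upperHalfPlaneSet \ A) := isOpen_upperHalfPlaneSet.sdiff hAc
  have hUpc : IsPathConnected (upperHalfPlaneSet \ A) := hA.1.2.2.isPathConnected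
  -- a closed ball at `0` off `A`
  obtain ⟨r₀, hr₀, hball⟩ : ∃ r₀ > 0, closedBall (0 : ℂ) r₀ ⊆ Aᶜ :=
    nhds_basis_closedBall.mem_iff.1 (hAc.isOpen_compl.mem_nhds hA.zero_notMem)
  obtain ⟨R, hRpos, hR⟩ := hA.isBoundedHull.1.subset_closedBall_lt 0 0
  set z₁ : ℂ := ((r₀ / 2 : ℝ) : ℂ) * I with hz₁
  set z₂ : ℂ := ((R + 1 : ℝ) : ℂ) * I with hz₂
  have hz₁H : z₁ ∈ upperHalfPlaneSet := by
    show 0 < z₁.im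
    simp [hz₁, hr₀]
  have hz₁ball : z₁ ∈ ball (0 : ℂ) r₀ := by
    rw [mem_ball_zero_iff, hz₁, norm_mul, Complex.norm_real, Complex.norm_I, mul_one,
      Real.norm_eq_abs, abs_of_pos (by positivity)]
    linarith
  have hz₁U : z₁ ∈ upperHalfPlaneSet \ A :=
    ⟨hz₁H, fun h ↦ hball (ball_subset_closedBall hz₁ball) h⟩
  have hz₂H : z₂ ∈ upperHalfPlaneSet := by
    show 0 < z₂.im
    simp [hz₂]
    linarith
  have hnorm₂ : ‖z₂‖ = R + 1 := by
    rw [hz₂, norm_mul, Complex.norm_real, Complex.norm_I, mul_one, Real.norm_eq_abs,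
      abs_of_pos (by linarith)]
  have hz₂U : z₂ ∈ upperHalfPlaneSet \ A := by
    refine ⟨hz₂H, fun h ↦ ?_⟩
    have := hR h
    rw [mem_closedBall, dist_zero_right, hnorm₂] at this
    linarith
  obtain ⟨p, hp⟩ := (hUpc.joinedIn z₁ hz₁U z₂ hz₂U)
  -- the compact part and its distance from `A`
  set C₀ : Set ℂ := (closedBall (0 : ℂ) r₀ ∩ {z : ℂ | 0 ≤ z.im}) ∪ range p with hC₀
  have hC₀c : IsCompact C₀ :=
    ((isCompact_closedBall _ _).inter_right (isClosed_le continuous_const continuous_im)).union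
      (isCompact_range p.continuous)
  have hC₀A : Disjoint C₀ A := by
    rw [Set.disjoint_left]
    rintro z (⟨hz, -⟩ | ⟨t, rfl⟩) hzA
    · exact hball hz hzA
    · exact (hp t).2 hzA
  obtain ⟨δ, hδ, hδd⟩ := hC₀A.symm.exists_cthickenings hA.isBoundedHull.isCompact hC₀c.isClosed
  refine ⟨min δ 1, lt_min hδ one_pos, fun s hs0 hs h0 ↦ ?_⟩
  have hsδ : s < δ := hs.trans_le (min_le_left _ _)
  have hs1 : s < 1 := hs.trans_le (min_le_right _ _)
  -- the connected unbounded set `Γ`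
  set Γ : Set ℂ := (ball (0 : ℂ) r₀ ∩ upperHalfPlaneSet) ∪ range p ∪ upRay z₂ with hΓ
  have hΓS : Γ ⊆ upperHalfPlaneSet \ nbhdSet A s := by
    rintro z ((⟨hz, hzH⟩ | ⟨t, rfl⟩) | hz)
    · refine ⟨hzH, fun hzS ↦ ?_⟩
      refine Set.disjoint_left.1 hδd (cthickening_mono hsδ.le A hzS.1)
        (self_subset_cthickening _ (Or.inl ⟨ball_subset_closedBall hz, le_of_lt (show (0 : ℝ) < z.im from hzH)⟩))
    · refine ⟨(hp t).1, fun hzS ↦ ?_⟩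
      exact Set.disjoint_left.1 hδd (cthickening_mono hsδ.le A hzS.1)
        (self_subset_cthickening _ (Or.inr ⟨t, rfl⟩))
    · have hzn : R + 1 ≤ ‖z‖ := hnorm₂ ▸ norm_le_of_mem_upRay hz₂H.le hz
      have hzim : 0 < z.im := by
        have := (mem_upRay_iff.1 hz).2
        exact hz₂H.trans_le this
      refine ⟨hzim, fun hzS ↦ ?_⟩
      obtain ⟨⟨a, ha, hza⟩, -⟩ := (mem_nbhdSet_iff hA.isBoundedHull.isCompact hs0).1 hzS
      have haR : ‖a‖ ≤ R := by
        have := hR ha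
        rwa [mem_closedBall, dist_zero_right] at this
      have : ‖z‖ ≤ ‖z - a‖ + ‖a‖ := by
        calc ‖z‖ = ‖(z - a) + a‖ := by ring_nf
          _ ≤ ‖z - a‖ + ‖a‖ := norm_add_le _ _
      rw [← dist_eq_norm] at this
      linarith
  have hΓc : IsPreconnected Γ := by
    refine IsPreconnected.union z₂ (Or.inr ⟨1, by simp⟩) (self_mem_upRay z₂) ?_
      (isConnected_upRay z₂).isPreconnected
    refine IsPreconnected.union z₁ ⟨hz₁ball, hz₁H⟩ ⟨0, by simp⟩ ?_
      (isConnected_range p.continuous).isPreconnected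
    exact ((convex_ball (0 : ℂ) r₀).inter (convex_halfSpace_im_gt 0)).isPreconnected
  have hΓb : ¬ IsBounded Γ := fun hb ↦ not_isBounded_upRay z₂ (hb.subset subset_union_right)
  have hΓV := subset_unboundedComponent_of_isPreconnected hΓc hΓS hΓb
  -- `0` is not in the closure of `ℍ ∖ V`
  rw [thickHull, hpFill, mem_closure_iff_nhds] at h0
  obtain ⟨w, hw, hwHV⟩ := h0 _ (ball_mem_nhds (0 : ℂ) hr₀)
  exact hwHV.2 (hΓV (Or.inl (Or.inl ⟨hw, hwHV.1⟩)))

/-- **The thickened hulls of a `*`-hull are `*`-hulls** for small `s > 0` (given the classical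
criterion `isSimplyConnected_of_isConnected_compl`, hypothesis `hFa`). [cite: LawlerSchrammWerner2003Restriction, §2 p. 8 (Fillings, *-hulls)] -/
theorem exists_forall_isStarHull_thickHull (hFa : isSimplyConnected_of_isConnected_compl)
    (hA : IsStarHull A) :
    ∃ s₀ : ℝ, 0 < s₀ ∧ ∀ s, 0 ≤ s → s < s₀ → IsStarHull (thickHull A s) := by
  obtain ⟨s₀, hs₀, h0⟩ := exists_forall_zero_notMem_thickHull hA
  refine ⟨s₀, hs₀, fun s hs hss ↦ ?_⟩
  exact isStarHull_hpFill hFa (isClosed_nbhdSet A s) (isBounded_nbhdSet hA.isBoundedHull.1 s)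
    (isConnected_nbhdSet_union hA.isBoundedHull hs) (h0 s hs hss)

/-- **Each thickened hull lies in the interior of the next**: for `s < s'`,
`thickHull A s ∩ ℍ ⊆ interior (thickHull A s')`. A point of the fill in `ℍ` is either within `s`
of `A` — then a small ball around it is within `s'` of `A` — or in a bounded component of the
complement of the `s`-neighbourhood, an open set inside the bigger fill. [folklore] -/
theorem thickHull_inter_subset_interior (hA : IsBounded A) (hs : 0 ≤ s) (hss : s < s') :
    thickHull A s ∩ upperHalfPlaneSet ⊆ interior (thickHull A s') := by
  intro z hz
  have hS := isClosed_nbhdSet A s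
  have hSb := isBounded_nbhdSet hA s
  rw [thickHull, hpFill_inter hS hSb] at hz
  obtain ⟨hzH, hzV⟩ := hz
  by_cases hzS : z ∈ nbhdSet A s
  · -- a ball around `z` inside `ℍ` and within `s'` of `A`
    rw [mem_interior_iff_mem_nhds]
    have hr : 0 < min (s' - s) z.im := lt_min (sub_pos.2 hss) hzH
    refine mem_of_superset (ball_mem_nhds z hr) fun w hw ↦ ?_
    rw [mem_ball] at hw
    have hwH : w ∈ upperHalfPlaneSet := by
      show 0 < w.im
      have h1 : |(z - w).im| ≤ ‖z - w‖ := Complex.abs_im_le_norm _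
      rw [← dist_eq_norm, dist_comm] at h1
      have h2 : (z - w).im = z.im - w.im := sub_im _ _
      rw [h2] at h1
      have := (abs_le.1 h1).2
      linarith [min_le_right (s' - s) z.im]
    have hwS : w ∈ nbhdSet A s' := by
      refine ⟨?_, le_of_lt (show (0 : ℝ) < w.im from hwH)⟩
      rw [mem_cthickening_iff]
      have hz' : infEDist z A ≤ ENNReal.ofReal s := mem_cthickening_iff.1 hzS.1
      calc infEDist w A ≤ infEDist z A + edist w z := infEDist_le_infEDist_add_edist
        _ ≤ ENNReal.ofReal s + ENNReal.ofReal (s' - s) := by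
          refine add_le_add hz' ?_
          rw [edist_dist]
          exact ENNReal.ofReal_le_ofReal (hw.le.trans (min_le_left _ _))
        _ = ENNReal.ofReal s' := by
          rw [← ENNReal.ofReal_add hs (sub_nonneg.2 hss.le)]
          congr 1
          ring
    exact (inter_subset_hpFill _) ⟨hwS, hwH⟩
  · -- the whole (open) component of `z` lies in the bigger fill
    rw [mem_interior_iff_mem_nhds]
    have hzU : z ∈ upperHalfPlaneSet \ nbhdSet A s := ⟨hzH, hzS⟩
    refine mem_of_superset (((isOpen_upperHalfPlaneSet.sdiff hS).connectedComponentIn).mem_nhds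
      (mem_connectedComponentIn hzU)) ?_
    exact connectedComponentIn_subset_hpFill (nbhdSet_mono A hss.le) hzU hzV

/-- **Outer continuity of avoidance**: a preconnected unbounded `L ⊆ ℍ` whose closure misses
the compact `A` misses `thickHull A s` for all small `s ≥ 0` — it runs inside the unbounded
component of the complement of a thin neighbourhood of `A`. [folklore] -/
theorem exists_forall_disjoint_thickHull (hA : IsCompact A) {L : Set ℂ}
    (hL : L ⊆ upperHalfPlaneSet) (hLc : IsPreconnected L) (hLb : ¬ IsBounded L)
    (hLA : Disjoint (closure L) A) :
    ∃ s₀ : ℝ, 0 < s₀ ∧ ∀ s, s ≤ s₀ → Disjoint L (thickHull A s) := by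
  obtain ⟨δ, hδ, hδd⟩ := hLA.symm.exists_cthickenings hA isClosed_closure
  refine ⟨δ, hδ, fun s hs ↦ ?_⟩
  have hS := isClosed_nbhdSet A s
  have hSb := isBounded_nbhdSet hA.isBounded s
  have hLS : L ⊆ upperHalfPlaneSet \ nbhdSet A s := fun z hz ↦
    ⟨hL hz, fun hzS ↦ Set.disjoint_left.1 hδd (cthickening_mono hs A hzS.1)
      (self_subset_cthickening _ (subset_closure hz))⟩
  have hLV := subset_unboundedComponent_of_isPreconnected hLc hLS hLb
  rw [← diff_hpFill hS hSb] at hLV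
  exact Set.disjoint_left.2 fun z hz ↦ (hLV hz).2

end Thick

/-! ### Images of configurations under restriction maps -/

section Image

variable {A' : Set ℂ} {Φ' : ConformalEquiv (upperHalfPlaneSet \ A') upperHalfPlaneSet}

/-- **Uniform version of `Φ'(z) → ∞`**: outside a large ball, `‖Φ'(z)‖ > M`. [folklore] -/
theorem IsRestrictionMap.exists_forall_lt_norm (hΦ' : IsRestrictionMap A' Φ') (M : ℝ) :
    ∃ R : ℝ, 0 < R ∧ ∀ z ∈ upperHalfPlaneSet \ A', R < ‖z‖ → M < ‖Φ' z‖ := by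
  have h := hΦ'.eventually_norm_le
  rw [eventually_inf_principal, Filter.Eventually, mem_cocompact] at h
  obtain ⟨C, hC, hCsub⟩ := h
  obtain ⟨R₀, hR₀⟩ := hC.isBounded.subset_closedBall 0
  refine ⟨max (max R₀ (2 * M)) 0 + 1, by positivity, fun z hz hzR ↦ ?_⟩
  have hzC : z ∉ C := fun hzC ↦ by
    have := hR₀ hzC
    rw [mem_closedBall, dist_zero_right] at this
    linarith [le_max_left R₀ (2 * M), le_max_left (max R₀ (2 * M)) 0]
  have h1 : ‖z‖ / 2 ≤ ‖Φ' z‖ := hCsub hzC hz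
  have h2 : 2 * M < ‖z‖ := by
    linarith [le_max_right R₀ (2 * M), le_max_left (max R₀ (2 * M)) 0]
  linarith

/-- The image of an unbounded subset of `ℍ ∖ A'` under a restriction map is unbounded. [folklore] -/
theorem IsRestrictionMap.not_isBounded_image (hΦ' : IsRestrictionMap A' Φ') {K : Set ℂ}
    (hK : K ⊆ upperHalfPlaneSet \ A') (hKb : ¬ IsBounded K) : ¬ IsBounded (Φ' '' K) := by
  intro hb
  obtain ⟨M, hM⟩ := hb.subset_closedBall 0
  obtain ⟨R, -, hR⟩ := hΦ'.exists_forall_lt_norm M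
  refine hKb ((isBounded_closedBall (x := (0 : ℂ)) (r := R)).subset fun z hz ↦ ?_)
  rw [mem_closedBall, dist_zero_right]
  by_contra h
  have := hM ⟨z, hz, rfl⟩
  rw [mem_closedBall, dist_zero_right] at this
  linarith [hR z (hK hz) (not_le.1 h)]

/-- **The image of a configuration accumulates on `ℝ` only at `0`**: if `K ⊆ ℍ ∖ A'` has
`closure K ⊆ K ∪ {0}`, then `closure (Φ'(K)) ⊆ Φ'(K) ∪ {0}` — a limit of `Φ'(z_j)`, `z_j ∈ K`,
comes from a bounded subsequence (`Φ' → ∞` at `∞`), whose limit point is in `K` (continuity) or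
is `0` (boundary value `Φ'(0) = 0`). [folklore] -/
theorem IsRestrictionMap.closure_image_subset (hΦ' : IsRestrictionMap A' Φ') (hA' : IsClosed A')
    {K : Set ℂ} (hK : K ⊆ upperHalfPlaneSet \ A') (hKcl : closure K ⊆ K ∪ {0}) :
    closure (Φ' '' K) ⊆ Φ' '' K ∪ {0} := by
  intro w hw
  have hU : IsOpen (upperHalfPlaneSet \ A') := isOpen_upperHalfPlaneSet.sdiff hA'
  -- split `K` at a large radius
  obtain ⟨R, -, hR⟩ := hΦ'.exists_forall_lt_norm (‖w‖ + 1)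
  have hsplit : Φ' '' K ⊆ Φ' '' (K ∩ closedBall 0 R) ∪ {v | ‖w‖ + 1 ≤ ‖v‖} := by
    rintro _ ⟨z, hz, rfl⟩
    by_cases hzR : ‖z‖ ≤ R
    · exact Or.inl ⟨z, ⟨hz, mem_closedBall_zero_iff.2 hzR⟩, rfl⟩
    · exact Or.inr (hR z (hK hz) (not_le.1 hzR)).le
  have hw' : w ∈ closure (Φ' '' (K ∩ closedBall 0 R)) := by
    have hcl : IsClosed {v : ℂ | ‖w‖ + 1 ≤ ‖v‖} := isClosed_le continuous_const continuous_norm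
    have := closure_mono hsplit hw
    rw [closure_union, hcl.closure_eq] at this
    rcases this with h | h
    · exact h
    · simp only [mem_setOf_eq] at h
      linarith
  -- a sequence in the bounded part
  obtain ⟨x, hx, hxw⟩ := mem_closure_iff_seq_limit.1 hw'
  choose z hz hzx using hx
  have hzC : ∀ n, z n ∈ closedBall (0 : ℂ) R := fun n ↦ (hz n).2
  obtain ⟨a, -, φ, hφ, hφa⟩ := (isCompact_closedBall (0 : ℂ) R).tendsto_subseq hzC
  have haK : a ∈ closure K := mem_closure_of_tendsto hφa (Eventually.of_forall fun n ↦ (hz (φ n)).1)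
  have hxφ : Tendsto (fun n ↦ Φ' (z (φ n))) atTop (𝓝 w) := by
    have : (fun n ↦ Φ' (z (φ n))) = x ∘ φ := funext fun n ↦ hzx (φ n)
    rw [this]
    exact hxw.comp hφ.tendsto_atTop
  rcases hKcl haK with haK | ha0
  · -- continuity at `a ∈ ℍ ∖ A'`
    have hca : ContinuousAt Φ' a := (Φ'.continuousOn a (hK haK)).continuousAt (hU.mem_nhds (hK haK))
    have : Tendsto (fun n ↦ Φ' (z (φ n))) atTop (𝓝 (Φ' a)) := hca.tendsto.comp hφa
    exact Or.inl ⟨a, haK, (tendsto_nhds_unique this hxφ)⟩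
  · -- boundary value at `0`
    rw [mem_singleton_iff] at ha0
    subst ha0
    have hw0 : Tendsto (fun n ↦ Φ' (z (φ n))) atTop (𝓝 0) := by
      refine hΦ'.1.comp (tendsto_nhdsWithin_iff.2 ⟨hφa, Eventually.of_forall fun n ↦ hK (hz (φ n)).1⟩)
    exact Or.inr (tendsto_nhds_unique hxφ hw0)

/-- **The extension of a restriction map by `Φ'(0) = 0` is continuous on `(ℍ ∖ A') ∪ {0}`**
(continuity inside the open domain; the boundary value at `0`). [folklore] -/
theorem IsRestrictionMap.continuousOn_update (hΦ' : IsRestrictionMap A' Φ') (hA' : IsClosed A') :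
    ContinuousOn (Function.update (⇑Φ') 0 0) ((upperHalfPlaneSet \ A') ∪ {0}) := by
  have hU : IsOpen (upperHalfPlaneSet \ A') := isOpen_upperHalfPlaneSet.sdiff hA'
  have h0U : (0 : ℂ) ∉ upperHalfPlaneSet \ A' := fun h ↦ by
    have : (0 : ℝ) < (0 : ℂ).im := h.1
    simp at this
  intro x hx
  rcases hx with hxU | hx0
  · have hx0 : x ≠ 0 := by
      rintro rfl
      exact h0U hxU
    have heq : (⇑Φ' : ℂ → ℂ) =ᶠ[𝓝 x] Function.update (⇑Φ') 0 0 := by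
      filter_upwards [isOpen_ne.mem_nhds hx0] with z hz
      exact (Function.update_of_ne hz _ _).symm
    have hca : ContinuousAt Φ' x := (Φ'.continuousOn x hxU).continuousAt (hU.mem_nhds hxU)
    exact (hca.congr heq).continuousWithinAt
  · rw [mem_singleton_iff] at hx0
    subst hx0
    show ContinuousWithinAt _ _ 0
    rw [ContinuousWithinAt, Function.update_self, nhdsWithin_union, nhdsWithin_singleton]
    refine Tendsto.sup ?_ ?_
    · refine (hΦ'.1).congr' ?_
      filter_upwards [self_mem_nhdsWithin] with z hz
      have hz0 : z ≠ 0 := by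
        rintro rfl
        exact h0U hz
      exact (Function.update_of_ne hz0 _ _).symm
    · have := tendsto_pure_nhds (Function.update (⇑Φ') 0 0) (0 : ℂ)
      rwa [Function.update_self] at this

/-- **A positive gap between `Φ'(S)` and a closed set `T ∌ 0`**, for `S ⊆ ℍ ∖ A'` with compact
closure inside `(ℍ ∖ A') ∪ {0}` whose points in `ℍ ∖ A'` are mapped off `T`: the continuous
extension by `Φ'(0) = 0` maps the closure of `S` onto a compact set missing `T`. [folklore] -/
theorem IsRestrictionMap.exists_pos_forall_le_dist (hΦ' : IsRestrictionMap A' Φ')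
    (hA' : IsClosed A') {S : Set ℂ} (hS : S ⊆ upperHalfPlaneSet \ A')
    (hScpt : IsCompact (closure S))
    (hScl : closure S ⊆ (upperHalfPlaneSet \ A') ∪ {0}) {T : Set ℂ} (hT : IsClosed T)
    (h0T : (0 : ℂ) ∉ T) (hST : ∀ z ∈ closure S, z ∈ upperHalfPlaneSet \ A' → Φ' z ∉ T) :
    ∃ η : ℝ, 0 < η ∧ ∀ z ∈ S, ∀ t ∈ T, η ≤ dist (Φ' z) t := by
  set f : ℂ → ℂ := Function.update (⇑Φ') 0 0 with hf
  have hfc : ContinuousOn f (closure S) := (hΦ'.continuousOn_update hA').mono hScl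
  have hQ : IsCompact (f '' closure S) := hScpt.image_of_continuousOn hfc
  have hQT : Disjoint (f '' closure S) T := by
    rw [Set.disjoint_left]
    rintro _ ⟨z, hz, rfl⟩ hzT
    rcases hScl hz with hzU | hz0
    · have hz0 : z ≠ 0 := by
        rintro rfl
        have : (0 : ℝ) < (0 : ℂ).im := hzU.1
        simp at this
      rw [hf, Function.update_of_ne hz0] at hzT
      exact hST z hz hzU hzT
    · rw [mem_singleton_iff] at hz0
      subst hz0
      rw [hf, Function.update_self] at hzT
      exact h0T hzT
  obtain ⟨δ, hδ, hδd⟩ := hQT.exists_cthickenings hQ hT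
  refine ⟨δ, hδ, fun z hz t ht ↦ ?_⟩
  by_contra hlt
  push Not at hlt
  have hz0 : z ≠ 0 := by
    rintro rfl
    have : (0 : ℝ) < (0 : ℂ).im := (hS hz).1
    simp at this
  have hfz : f z = Φ' z := by rw [hf, Function.update_of_ne hz0]
  have h1 : t ∈ cthickening δ (f '' closure S) := by
    refine thickening_subset_cthickening _ _ (mem_thickening_iff.2 ⟨f z, ⟨z, subset_closure hz, rfl⟩, ?_⟩)
    rwa [hfz, dist_comm]
  exact Set.disjoint_left.1 hδd h1 (self_subset_cthickening _ ht)

end Image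

/-! ### A uniform far-field bound along a convergent sequence of restriction maps -/

section FarField

variable {U V : Set ℂ}

/-- The image of an open subset under a conformal equivalence between open sets is open. [folklore] -/
theorem ConformalEquiv.isOpen_image (φ : ConformalEquiv U V) (hV : IsOpen V) {W : Set ℂ}
    (hW : IsOpen W) (hWU : W ⊆ U) : IsOpen (φ '' W) := by
  have : φ '' W = V ∩ φ.symm ⁻¹' W := by
    ext w
    constructor
    · rintro ⟨z, hz, rfl⟩
      exact ⟨φ.mapsTo (hWU hz), by rw [mem_preimage, φ.symm_apply_apply (hWU hz)]; exact hz⟩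
    · rintro ⟨hwV, hw⟩
      exact ⟨φ.symm w, hw, φ.apply_symm_apply hwV⟩
  rw [this]
  exact φ.symm.continuousOn.isOpen_inter_preimage hV hW

variable {A' : Set ℂ} {J : ℕ → Set ℂ}
  {Φ' : ConformalEquiv (upperHalfPlaneSet \ A') upperHalfPlaneSet}
  {Ψ : ∀ n, ConformalEquiv (upperHalfPlaneSet \ J n) upperHalfPlaneSet}

/-- **Uniform far-field bound.** Let `A' ⊆ F ⊆ J n ⊆ J 0` be `*`-hulls with restriction maps
`Φ'`, `Ψ n`, and suppose `Ψ n → Φ'` uniformly on every `S ⊆ ℍ` with compact closure missing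
`F`. Then for every `M` there is `R` such that for all large `n`: `‖Ψ n z‖ > M` whenever
`z ∈ ℍ ∖ J n`, `‖z‖ > R`. Proof: on a large half-circle `C = {|z| = R} ∩ ℍ`, `‖Φ'‖ > M + 1`, so
`‖Ψ n‖ > M + 1/2` on `C` for large `n`; the connected half-ball `{|w| < M + 1/2} ∩ ℍ` misses
`Ψ n (C)` and meets the image of the inner region (points near `0 = Ψ n(0)`), so it lies inside
that image and misses the image of the outer region. [folklore] -/
theorem exists_forall_lt_norm_apply (hJ : ∀ n, IsStarHull (J n))
    (hJm : Antitone J) {F : Set ℂ} (hFJ : ∀ n, F ⊆ J n) (hA'F : A' ⊆ F)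
    (hΦ' : IsRestrictionMap A' Φ') (hΨ : ∀ n, IsRestrictionMap (J n) (Ψ n))
    (huc : ∀ S ⊆ upperHalfPlaneSet, IsCompact (closure S) → Disjoint (closure S) F →
      TendstoUniformlyOn (fun n z ↦ Ψ n z) (fun z ↦ Φ' z) atTop S)
    (M : ℝ) : ∃ R : ℝ, 0 < R ∧ ∀ᶠ n in atTop, ∀ z ∈ upperHalfPlaneSet \ J n, R < ‖z‖ → M < ‖Ψ n z‖ := by
  -- without loss of generality `0 ≤ M`
  wlog hM : 0 ≤ M generalizing M
  · obtain ⟨R, hR, h⟩ := this 0 le_rfl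
    exact ⟨R, hR, h.mono fun n hn z hz hzR ↦ (not_le.1 hM).trans (hn z hz hzR)⟩
  -- radii
  obtain ⟨R₁, hR₁, hfar⟩ := hΦ'.exists_forall_lt_norm (|M| + 1)
  obtain ⟨R₀, hR₀pos, hR₀⟩ := (hJ 0).isBoundedHull.1.subset_closedBall_lt 0 0
  set ρ : ℝ := max R₁ R₀ + 1 with hρ
  have hρR₁ : R₁ < ρ := by rw [hρ]; linarith [le_max_left R₁ R₀]
  have hρR₀ : R₀ < ρ := by rw [hρ]; linarith [le_max_right R₁ R₀]
  have hρpos : 0 < ρ := hR₀pos.trans hρR₀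
  have hJρ : ∀ n, ∀ z ∈ J n, ‖z‖ ≤ R₀ := fun n z hz ↦ by
    have := hR₀ (hJm (Nat.zero_le n) hz)
    rwa [mem_closedBall, dist_zero_right] at this
  have hFρ : ∀ z ∈ F, ‖z‖ ≤ R₀ := fun z hz ↦ hJρ 0 z (hFJ 0 hz)
  have hA'ρ : ∀ z ∈ A', ‖z‖ ≤ R₀ := fun z hz ↦ hFρ z (hA'F hz)
  -- the half-circle
  set C : Set ℂ := {z : ℂ | ‖z‖ = ρ} ∩ upperHalfPlaneSet with hCdef
  have hCsub : C ⊆ upperHalfPlaneSet := inter_subset_right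
  have hCcl : closure C ⊆ {z : ℂ | ‖z‖ = ρ} := by
    refine (closure_mono inter_subset_left).trans (IsClosed.closure_subset ?_)
    exact isClosed_eq continuous_norm continuous_const
  have hCcpt : IsCompact (closure C) :=
    (isCompact_sphere (0 : ℂ) ρ).of_isClosed_subset isClosed_closure
      (hCcl.trans fun z hz ↦ by simpa using hz)
  have hCF : Disjoint (closure C) F := by
    rw [Set.disjoint_left]
    intro z hz hzF
    have h1 := hCcl hz
    simp only [mem_setOf_eq] at h1
    linarith [hFρ z hzF]
  have huC := huc C hCsub hCcpt hCF
  rw [Metric.tendstoUniformlyOn_iff] at huC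
  have hev := huC (1 / 2) (by norm_num)
  refine ⟨ρ, hρpos, ?_⟩
  filter_upwards [hev] with n hn
  -- notation for this `n`
  set Un : Set ℂ := upperHalfPlaneSet \ J n with hUn
  have hUo : IsOpen Un := isOpen_upperHalfPlaneSet.sdiff (hJ n).isBoundedHull.isClosed
  have hCU : C ⊆ Un := fun z hz ↦ ⟨hz.2, fun hzJ ↦ by
    have := hJρ n z hzJ
    simp only [hCdef, mem_inter_iff, mem_setOf_eq] at hz
    linarith⟩
  -- on the half-circle the image is far
  have himC : ∀ z ∈ C, M + 1 / 2 < ‖Ψ n z‖ := fun z hz ↦ by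
    have h1 : |M| + 1 < ‖Φ' z‖ := hfar z ⟨hz.2, fun hzA ↦ by
      have := hA'ρ z hzA
      simp only [hCdef, mem_inter_iff, mem_setOf_eq] at hz
      linarith⟩ (by simp only [hCdef, mem_inter_iff, mem_setOf_eq] at hz; linarith)
    have h2 : dist (Φ' z) (Ψ n z) < 1 / 2 := hn z hz
    rw [dist_eq_norm] at h2
    have h3 := norm_sub_norm_le (Φ' z) (Ψ n z)
    linarith [le_abs_self M]
  -- inner and outer regions
  set I : Set ℂ := {z : ℂ | ‖z‖ < ρ} ∩ Un with hIdef
  set O : Set ℂ := {z : ℂ | ρ < ‖z‖} ∩ upperHalfPlaneSet with hOdef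
  have hIU : I ⊆ Un := inter_subset_right
  have hOU : O ⊆ Un := fun z hz ↦ ⟨hz.2, fun hzJ ↦ by
    have := hJρ n z hzJ
    simp only [hOdef, mem_inter_iff, mem_setOf_eq] at hz
    linarith⟩
  have hIo : IsOpen I := (isOpen_lt continuous_norm continuous_const).inter hUo
  have hOo : IsOpen O := (isOpen_lt continuous_const continuous_norm).inter isOpen_upperHalfPlaneSet
  have hIo' : IsOpen (Ψ n '' I) := (Ψ n).isOpen_image isOpen_upperHalfPlaneSet hIo hIU
  have hOo' : IsOpen (Ψ n '' O) := (Ψ n).isOpen_image isOpen_upperHalfPlaneSet hOo hOU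
  have hdisj : Disjoint (Ψ n '' I) (Ψ n '' O) := by
    rw [Set.disjoint_left]
    rintro _ ⟨z, hz, rfl⟩ ⟨z', hz', he⟩
    have := (Ψ n).injOn (hOU hz') (hIU hz) he
    subst this
    simp only [hIdef, hOdef, mem_inter_iff, mem_setOf_eq] at hz hz'
    linarith [hz.1, hz'.1]
  -- the small half-ball
  set H : Set ℂ := ball (0 : ℂ) (M + 1 / 2) ∩ upperHalfPlaneSet with hHdef
  have hHc : IsPreconnected H := ((convex_ball (0 : ℂ) _).inter (convex_halfSpace_im_gt 0)).isPreconnected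
  have hHsub : H ⊆ Ψ n '' I ∪ Ψ n '' O := by
    rintro w ⟨hwM, hwH⟩
    rw [mem_ball_zero_iff] at hwM
    -- `w = Ψ n z` for some `z ∈ Un`
    obtain ⟨z, hz, rfl⟩ : w ∈ Ψ n '' Un := by
      rw [(Ψ n).bijOn.image_eq]; exact hwH
    rcases lt_trichotomy ‖z‖ ρ with h | h | h
    · exact Or.inl ⟨z, ⟨h, hz⟩, rfl⟩
    · exact absurd (himC z ⟨h, hz.1⟩) (by linarith)
    · exact Or.inr ⟨z, ⟨h, hz.1⟩, rfl⟩
  -- `H` meets the image of the inner region: points near `0`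
  have hHI : (H ∩ Ψ n '' I).Nonempty := by
    have h0 : (0 : ℂ) ∈ closure Un := (hJ n).zero_mem_closure_diff
    have hne : (𝓝[Un] (0 : ℂ)).NeBot := mem_closure_iff_nhdsWithin_neBot.1 h0
    have hM' : 0 < M + 1 / 2 := by linarith
    have h1 : ∀ᶠ z in 𝓝[Un] (0 : ℂ), Ψ n z ∈ ball (0 : ℂ) (M + 1 / 2) :=
      (hΨ n).1 (ball_mem_nhds _ hM')
    have h2 : ∀ᶠ z in 𝓝[Un] (0 : ℂ), z ∈ ball (0 : ℂ) ρ :=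
      mem_nhdsWithin_of_mem_nhds (ball_mem_nhds _ hρpos)
    have h3 : ∀ᶠ z in 𝓝[Un] (0 : ℂ), z ∈ Un := eventually_mem_nhdsWithin
    obtain ⟨z, hz1, hz2, hz3⟩ := (h1.and (h2.and h3)).exists
    exact ⟨Ψ n z, ⟨hz1, (Ψ n).mapsTo hz3⟩, z, ⟨mem_ball_zero_iff.1 hz2, hz3⟩, rfl⟩
  -- hence `H` lies inside the image of the inner region
  have hHI' : H ⊆ Ψ n '' I := by
    rcases hHc.subset_or_subset hIo' hOo' hdisj hHsub with h | h
    · exact h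
    · exfalso
      obtain ⟨p, hpH, hpI⟩ := hHI
      exact Set.disjoint_left.1 hdisj hpI (h hpH)
  -- conclusion
  intro z hz hzR
  by_contra hle
  have hzO : z ∈ O := ⟨hzR, hz.1⟩
  have hw : Ψ n z ∈ H := by
    refine ⟨mem_ball_zero_iff.2 (by linarith [not_lt.1 hle]), (Ψ n).mapsTo hz⟩
  exact Set.disjoint_left.1 hdisj (hHI' hw) ⟨z, hzO, rfl⟩

end FarField


end Literature.Probability.RandomPlanarGeometry

end
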